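import Literature.Geometry.DiscreteGeometry.ConeTiling
import Literature.Geometry.DiscreteGeometry.SphericalPolygonArea
import HarnessLib

/-!
# Convex polygonal cones: vertex description, tangent wedges, Girard in vertex form

Topic `Literature/Geometry/DiscreteGeometry`.  Brick C₁ of the face theory of spherical
subdivisions (Legendre's proof of Euler's formula; Musin–Tarasov 2012 §3), completing the
facet-form polygonal cone `polyCone n w = ⋂ᵢ {det[wᵢ; wᵢ₊₁; ·] ≥ 0}` of
`SphericalPolygonArea.lean` (whose solid angle is Girard's excess `Σ polyDih − (n − 2)π`,
`ballFraction_polyCone`) by its VERTEX description and by the intrinsic form of its angles.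
For `w 0, …, w (n−1) ∈ ℝ³`, `n ≥ 3`, with all cyclically ordered triples positively oriented:

* `orient3_consec_pos`, `mem_polyCone_vertex`: each edge ray `w j` lies in the cone, strictly
  inside every facet half-space except the two through it;
* `convex_polyCone`, `smul_mem_polyCone`, `coneOver S = {t • p | t ≥ 0, p ∈ conv S}`,
  **`polyCone_eq_coneOver`**: the cone is the cone over the convex hull of its edge rays
  (`⊇`: convexity; `⊆`: the fan decomposition `polyCone (n+1) w ⊆ polyCone n w ∪ T(w₀, wₙ₋₁, wₙ)`
  of `ballFraction_polyCone` and the vertex form of a trihedral cone,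
  `setOf_orient3_inter₃_eq_apexCone`);
* **`dirCone_polyCone_vertex`**: the cone of feasible directions (`ConeTiling.dirCone`) of the
  cone at the vertex `w j` is the dihedral WEDGE of the two facets through `w j`;
  `setOf_orient3_inter_eq_apexWedge`, `ballFraction_orient3_wedge`: that wedge is
  `apexWedge 0 (w j) ![w (j−1), w (j+1)]` and its ball fraction is `polyDih n w j / 2π`
  (`dihedralFraction_eq_angle_div`), whence `ballFraction_dirCone_polyCone_vertex`;
* **`ballFraction_polyCone_eq_sum_dirCone`** — Girard's theorem in intrinsic (vertex-wedge)
  form: `ballFraction 0 (polyCone n w) = ½ Σⱼ ballFraction 0 (dirCone (polyCone n w) (w j))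
  − (n − 2)/4`, i.e. `area = Σ (vertex angles) − (n − 2)π` with each vertex angle read off as
  the volume fraction of the tangent wedge — the form in which the angles at a vertex of a
  spherical subdivision visibly sum to `2π` (`ConeTiling.sum_ballFraction_dirCone_argmaxCone`).

Everything is PROVED; no named facts.

## References
* A.-M. Legendre, *Éléments de géométrie* (1794), VII, Prop. XXIII–XXV (Girard, Euler).
  [folklore]
* O. R. Musin, A. S. Tarasov, *The strong thirteen spheres problem*, DCG 48 (2012), §3.
  [`MusinTarasov2012`]
-/

noncomputable section

namespace Literature.Geometry.DiscreteGeometry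

open Real RealInnerProductSpace MeasureTheory Metric Set InnerProductGeometry

local notation "E3" => EuclideanSpace ℝ (Fin 3)

/-! ### Part 1. Edge rays of a cyclically oriented polygonal cone -/

section Vertices

/-- **The facet functional of edge `i` is positive at every other edge ray.**  For a cyclically
positively oriented family and `j ∉ {i, i+1 (mod n)}`: `det[w i; w (i+1); w j] > 0`.
[folklore] -/
theorem orient3_consec_pos {n : ℕ} {w : ℕ → E3}
    (hw : ∀ i j k, i < j → j < k → k < n → 0 < orient3 (w i) (w j) (w k)) {i j : ℕ}
    (hi : i < n) (hj : j < n) (hji : j ≠ i) (hji' : j ≠ (i + 1) % n) :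
    0 < orient3 (w i) (w ((i + 1) % n)) (w j) := by
  rcases Nat.lt_or_ge (i + 1) n with h1 | h1
  · rw [Nat.mod_eq_of_lt h1] at hji' ⊢
    rcases Nat.lt_or_gt_of_ne hji with hlt | hlt
    · rw [← orient3_cyclic]
      exact hw j i (i + 1) hlt (Nat.lt_succ_self i) h1
    · exact hw i (i + 1) j (Nat.lt_succ_self i) (by omega) hj
  · obtain rfl : i = n - 1 := by omega
    have hn : n - 1 + 1 = n := by omega
    rw [hn, Nat.mod_self] at hji' ⊢
    rw [orient3_cyclic]
    exact hw 0 j (n - 1) (by omega) (by omega) (by omega)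

/-- The facet functional of edge `i` vanishes at the two edge rays through it … the second
one: `det[w i; w (i+1); w (i+1)] = 0` in modular form. [folklore] -/
theorem succ_pred_mod {n j : ℕ} (hn : 1 ≤ n) (hj : j < n) : ((j + n - 1) % n + 1) % n = j := by
  rcases Nat.eq_zero_or_pos j with rfl | hpos
  · rw [Nat.zero_add, Nat.mod_eq_of_lt (by omega : n - 1 < n), Nat.sub_add_cancel hn,
      Nat.mod_self]
  · rw [show j + n - 1 = (j - 1) + n by omega, Nat.add_mod_right,
      Nat.mod_eq_of_lt (by omega : j - 1 < n), Nat.sub_add_cancel hpos, Nat.mod_eq_of_lt hj]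

/-- **Each edge ray lies in the cone.** [folklore] -/
theorem mem_polyCone_vertex {n : ℕ} {w : ℕ → E3}
    (hw : ∀ i j k, i < j → j < k → k < n → 0 < orient3 (w i) (w j) (w k)) {j : ℕ}
    (hj : j < n) : w j ∈ polyCone n w := by
  intro i hi
  by_cases h1 : j = i
  · rw [h1, orient3_self_outer]
  by_cases h2 : j = (i + 1) % n
  · rw [← h2, orient3_self_right]
  exact (orient3_consec_pos hw hi hj h1 h2).le

/-- Polygonal cones are invariant under nonnegative dilations. [folklore] -/
theorem smul_mem_polyCone {n : ℕ} {w : ℕ → E3} {x : E3} (hx : x ∈ polyCone n w) {t : ℝ}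
    (ht : 0 ≤ t) : t • x ∈ polyCone n w := fun i hi => by
  rw [orient3_smul_right]
  exact mul_nonneg ht (hx i hi)

/-- Polygonal cones are closed under addition. [folklore] -/
theorem add_mem_polyCone {n : ℕ} {w : ℕ → E3} {x y : E3} (hx : x ∈ polyCone n w)
    (hy : y ∈ polyCone n w) : x + y ∈ polyCone n w := fun i hi => by
  rw [orient3_add_right]
  exact add_nonneg (hx i hi) (hy i hi)

/-- Polygonal cones are convex. [folklore] -/
theorem convex_polyCone (n : ℕ) (w : ℕ → E3) : Convex ℝ (polyCone n w) := by
  intro x hx y hy a b ha hb _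
  exact add_mem_polyCone (smul_mem_polyCone hx ha) (smul_mem_polyCone hy hb)

end Vertices

/-! ### Part 2. The cone over a set and the vertex description of a polygonal cone -/

section ConeOver

variable {V : Type*} [AddCommGroup V] [Module ℝ V]

/-- **The cone over a set**: `{t • p | t ≥ 0, p ∈ conv S}` (the convex cone with apex `0`
spanned by `S`, together with `0`). [folklore] -/
def coneOver (S : Set V) : Set V :=
  {x | ∃ t : ℝ, 0 ≤ t ∧ ∃ p ∈ convexHull ℝ S, x = t • p}

/-- Membership in `coneOver`, unfolded. [folklore] -/
theorem mem_coneOver_iff (S : Set V) (x : V) :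
    x ∈ coneOver S ↔ ∃ t : ℝ, 0 ≤ t ∧ ∃ p ∈ convexHull ℝ S, x = t • p :=
  Iff.rfl

/-- `coneOver` is monotone. [folklore] -/
theorem coneOver_mono {S T : Set V} (h : S ⊆ T) : coneOver S ⊆ coneOver T :=
  fun _ ⟨t, ht, p, hp, hx⟩ => ⟨t, ht, p, convexHull_mono h hp, hx⟩

/-- Points of the hull lie in the cone over the set. [folklore] -/
theorem mem_coneOver_of_mem_convexHull {S : Set V} {p : V} (hp : p ∈ convexHull ℝ S) :
    p ∈ coneOver S :=
  ⟨1, zero_le_one, p, hp, (one_smul ℝ p).symm⟩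

/-- **A finitely generated cone lies in the cone over its generators**:
`apexCone 0 u ⊆ coneOver (range u)` (for a nonempty index type). [folklore] -/
theorem apexCone_zero_subset_coneOver {ι : Type*} [Fintype ι] [Nonempty ι] (u : ι → V) :
    apexCone 0 u ⊆ coneOver (Set.range u) := by
  classical
  rintro x ⟨c, hc, rfl⟩
  rw [zero_add]
  set s : ℝ := ∑ i, c i with hs
  have hs0 : 0 ≤ s := Finset.sum_nonneg fun i _ => hc i
  rcases hs0.eq_or_lt with h0 | hpos
  · -- all coefficients vanish
    have hci : ∀ i, c i = 0 := fun i =>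
      (Finset.sum_eq_zero_iff_of_nonneg (fun i _ => hc i)).1 h0.symm i (Finset.mem_univ i)
    obtain ⟨i₀⟩ := ‹Nonempty ι›
    refine ⟨0, le_rfl, u i₀, subset_convexHull ℝ _ ⟨i₀, rfl⟩, ?_⟩
    rw [zero_smul]
    exact Finset.sum_eq_zero fun i _ => by rw [hci i, zero_smul]
  · refine ⟨s, hs0, ∑ i, (c i / s) • u i, ?_, ?_⟩
    · refine (convex_convexHull ℝ (Set.range u)).sum_mem (fun i _ => div_nonneg (hc i) hs0)
        ?_ (fun i _ => subset_convexHull ℝ _ ⟨i, rfl⟩)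
      rw [← Finset.sum_div, div_self hpos.ne']
    · rw [Finset.smul_sum]
      exact Finset.sum_congr rfl fun i _ => by rw [smul_smul, mul_div_cancel₀ _ hpos.ne']

end ConeOver

section VertexDescription

/-- The hull of the edge rays lies in the cone. [folklore] -/
theorem convexHull_subset_polyCone {n : ℕ} {w : ℕ → E3}
    (hw : ∀ i j k, i < j → j < k → k < n → 0 < orient3 (w i) (w j) (w k)) :
    convexHull ℝ (w '' Set.Iio n) ⊆ polyCone n w := by
  refine convexHull_min ?_ (convex_polyCone n w)
  rintro _ ⟨j, hj, rfl⟩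
  exact mem_polyCone_vertex hw hj

/-- … hence so does the cone over them. [folklore] -/
theorem coneOver_subset_polyCone {n : ℕ} {w : ℕ → E3}
    (hw : ∀ i j k, i < j → j < k → k < n → 0 < orient3 (w i) (w j) (w k)) :
    coneOver (w '' Set.Iio n) ⊆ polyCone n w := by
  rintro x ⟨t, ht, p, hp, rfl⟩
  exact smul_mem_polyCone (convexHull_subset_polyCone hw hp) ht

/-- **The fan step**: `polyCone (n+1) w ⊆ polyCone n w ∪ T(w 0, w (n−1), w n)` with the
trihedral piece in facet form (no orientation hypothesis needed for this inclusion).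
[folklore] -/
theorem polyCone_succ_subset {n : ℕ} (hn : 3 ≤ n) (w : ℕ → E3) :
    polyCone (n + 1) w ⊆ polyCone n w ∪
      ({x : E3 | 0 ≤ orient3 (w (n - 1)) (w n) x} ∩ {x | 0 ≤ orient3 (w n) (w 0) x} ∩
        {x | 0 ≤ orient3 (w 0) (w (n - 1)) x}) := by
  intro x hx
  have hlast : 0 ≤ orient3 (w n) (w 0) x := by
    have := hx n (Nat.lt_succ_self n)
    rwa [Nat.mod_self] at this
  have hprev : 0 ≤ orient3 (w (n - 1)) (w n) x := by
    have := hx (n - 1) (by omega)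
    rwa [show n - 1 + 1 = n by omega, Nat.mod_eq_of_lt (Nat.lt_succ_self n)] at this
  rcases le_or_gt 0 (orient3 (w 0) (w (n - 1)) x) with hD | hD
  · exact Or.inr ⟨⟨hprev, hlast⟩, hD⟩
  · refine Or.inl fun i hi => ?_
    rcases Nat.lt_or_ge (i + 1) n with h1 | h1
    · have := hx i (by omega)
      rwa [Nat.mod_eq_of_lt (by omega : i + 1 < n + 1), ← Nat.mod_eq_of_lt h1] at this
    · obtain rfl : i = n - 1 := by omega
      rw [show n - 1 + 1 = n by omega, Nat.mod_self, orient3_swap_left]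
      linarith

/-- **The cone lies in the cone over its edge rays** (fan decomposition from `w 0`).
[folklore] -/
theorem polyCone_subset_coneOver (m : ℕ) :
    ∀ w : ℕ → E3, (∀ i j k, i < j → j < k → k < m + 3 → 0 < orient3 (w i) (w j) (w k)) →
      polyCone (m + 3) w ⊆ coneOver (w '' Set.Iio (m + 3)) := by
  induction m with
  | zero =>
    intro w hw x hx
    have h012 := hw 0 1 2 (by omega) (by omega) (by omega)
    have hmem : x ∈ {x : E3 | 0 ≤ orient3 (w 1) (w 2) x} ∩ {x | 0 ≤ orient3 (w 2) (w 0) x} ∩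
        {x | 0 ≤ orient3 (w 0) (w 1) x} :=
      ⟨⟨by simpa using hx 1 (by omega), by simpa using hx 2 (by omega)⟩,
        by simpa using hx 0 (by omega)⟩
    rw [setOf_orient3_inter₃_eq_apexCone h012] at hmem
    refine coneOver_mono ?_ (apexCone_zero_subset_coneOver _ hmem)
    rintro _ ⟨i, rfl⟩
    fin_cases i
    · exact ⟨0, by simp, rfl⟩
    · exact ⟨1, by simp, rfl⟩
    · exact ⟨2, by simp, rfl⟩
  | succ m ih =>
    intro w hw x hx
    have hsub : w '' Set.Iio (m + 3) ⊆ w '' Set.Iio (m + 1 + 3) :=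
      Set.image_mono fun i (hi : i < m + 3) => (by simp only [Set.mem_Iio]; omega)
    rcases polyCone_succ_subset (by omega : 3 ≤ m + 3) w hx with h | h
    · exact coneOver_mono hsub (ih w (fun i j k hij hjk hk => hw i j k hij hjk (by omega)) h)
    · have hpos : 0 < orient3 (w 0) (w (m + 2)) (w (m + 3)) :=
        hw 0 (m + 2) (m + 3) (by omega) (by omega) (by omega)
      rw [show m + 3 - 1 = m + 2 by omega, setOf_orient3_inter₃_eq_apexCone hpos] at h
      refine coneOver_mono ?_ (apexCone_zero_subset_coneOver _ h)
      rintro _ ⟨i, rfl⟩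
      fin_cases i
      · exact ⟨0, by simp, rfl⟩
      · exact ⟨m + 2, by simp, rfl⟩
      · exact ⟨m + 3, by simp, rfl⟩

/-- **The vertex description of a polygonal cone**: for `n ≥ 3` edge rays with all cyclically
ordered triples positively oriented, `polyCone n w = coneOver {w 0, …, w (n−1)}`. [folklore] -/
theorem polyCone_eq_coneOver {n : ℕ} (hn : 3 ≤ n) {w : ℕ → E3}
    (hw : ∀ i j k, i < j → j < k → k < n → 0 < orient3 (w i) (w j) (w k)) :
    polyCone n w = coneOver (w '' Set.Iio n) := by
  obtain ⟨m, rfl⟩ : ∃ m, n = m + 3 := ⟨n - 3, by omega⟩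
  exact Set.Subset.antisymm (polyCone_subset_coneOver m w hw) (coneOver_subset_polyCone hw)

end VertexDescription

/-! ### Part 3. The tangent wedge at a vertex and its ball fraction -/

section Wedge

/-- A polygonal cone as a `halfspaceCone` of its `n` facet functionals. [folklore] -/
theorem polyCone_eq_halfspaceCone (n : ℕ) (w : ℕ → E3) :
    polyCone n w = halfspaceCone (Finset.range n) fun i => orient3Right (w i) (w ((i + 1) % n)) := by
  ext x
  simp only [polyCone, halfspaceCone, Set.mem_setOf_eq, Finset.mem_range, orient3Right_apply]

/-- **The facets active at the vertex `w j` are the two through it** (`i = j − 1, j` mod `n`).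
[folklore] -/
theorem filter_active_eq_pair {n : ℕ} (hn : 3 ≤ n) {w : ℕ → E3}
    (hw : ∀ i j k, i < j → j < k → k < n → 0 < orient3 (w i) (w j) (w k)) {j : ℕ}
    (hj : j < n) :
    (Finset.range n).filter (fun i => orient3Right (w i) (w ((i + 1) % n)) (w j) = 0) =
      {(j + n - 1) % n, j} := by
  ext i
  rw [Finset.mem_filter, Finset.mem_range, Finset.mem_insert, Finset.mem_singleton,
    orient3Right_apply]
  constructor
  · rintro ⟨hi, h0⟩
    by_contra hne
    push Not at hne
    have h1 : j ≠ i := fun h => hne.2 h.symm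
    have h2 : j ≠ (i + 1) % n := by
      intro h
      apply hne.1
      rw [h]
      rcases Nat.lt_or_ge (i + 1) n with h3 | h3
      · rw [Nat.mod_eq_of_lt h3, show i + 1 + n - 1 = i + n by omega, Nat.add_mod_right,
          Nat.mod_eq_of_lt hi]
      · obtain rfl : i = n - 1 := by omega
        rw [show n - 1 + 1 = n by omega, Nat.mod_self, Nat.zero_add,
          Nat.mod_eq_of_lt (by omega)]
    exact (orient3_consec_pos hw hi hj h1 h2).ne' h0
  · rintro (rfl | rfl)
    · refine ⟨Nat.mod_lt _ (by omega), ?_⟩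
      rw [succ_pred_mod (by omega) hj, orient3_self_right]
    · exact ⟨hj, by rw [orient3_self_outer]⟩

/-- **The cone of feasible directions of a polygonal cone at the vertex `w j` is the dihedral
wedge of the two facets through `w j`.** [folklore] -/
theorem dirCone_polyCone_vertex {n : ℕ} (hn : 3 ≤ n) {w : ℕ → E3}
    (hw : ∀ i j k, i < j → j < k → k < n → 0 < orient3 (w i) (w j) (w k)) {j : ℕ}
    (hj : j < n) :
    dirCone (polyCone n w) (w j) =
      {x : E3 | 0 ≤ orient3 (w ((j + n - 1) % n)) (w j) x} ∩
        {x | 0 ≤ orient3 (w j) (w ((j + 1) % n)) x} := by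
  classical
  rw [polyCone_eq_halfspaceCone,
    dirCone_halfspaceCone (Finset.range n) _ (by
      rw [← polyCone_eq_halfspaceCone]; exact mem_polyCone_vertex hw hj),
    filter_active_eq_pair hn hw hj]
  ext x
  simp only [halfspaceCone, Set.mem_setOf_eq, Finset.mem_insert, Finset.mem_singleton,
    Set.mem_inter_iff, orient3Right_apply, forall_eq_or_imp, forall_eq, succ_pred_mod (by omega : 1 ≤ n) hj]

/-- **A dihedral wedge in determinant form is an `apexWedge`**: for `det[a;b;c] > 0`,
`{det[a;b;·] ≥ 0} ∩ {det[b;c;·] ≥ 0} = apexWedge 0 b ![a, c]` (edge `b`, faces towards `a`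
and `c`). [folklore] -/
theorem setOf_orient3_inter_eq_apexWedge {a b c : E3} (h : 0 < orient3 a b c) :
    {x : E3 | 0 ≤ orient3 a b x} ∩ {x | 0 ≤ orient3 b c x} = apexWedge 0 (b - 0) ![a, c] := by
  ext x
  simp only [Set.mem_inter_iff, Set.mem_setOf_eq, apexWedge, sub_zero, zero_add,
    Fin.sum_univ_two, Matrix.cons_val_zero, Matrix.cons_val_one]
  constructor
  · rintro ⟨h1, h2⟩
    -- expand `x` in the basis `a, b, c`
    have hexp := orient3_expand a b c x
    refine ⟨orient3 a x c / orient3 a b c, ![orient3 x b c / orient3 a b c,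
      orient3 a b x / orient3 a b c], ?_, ?_⟩
    · intro i
      fin_cases i
      · show 0 ≤ orient3 x b c / orient3 a b c
        rw [← orient3_cyclic] at h2
        exact div_nonneg h2 h.le
      · show 0 ≤ orient3 a b x / orient3 a b c
        exact div_nonneg h1 h.le
    · simp only [Matrix.cons_val_zero, Matrix.cons_val_one]
      have hx : x = (orient3 a b c)⁻¹ • (orient3 x b c • a + orient3 a x c • b + orient3 a b x • c) := by
        rw [← hexp, inv_smul_smul₀ h.ne']
      conv_lhs => rw [hx]
      simp only [smul_add, smul_smul, div_eq_inv_mul]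
      abel
  · rintro ⟨s, coef, hcoef, rfl⟩
    have h0 := hcoef 0
    have h1 := hcoef 1
    simp only [orient3_add_right, orient3_smul_right, orient3_self_right, orient3_self_outer,
      mul_zero, add_zero, zero_add]
    have hbca : orient3 b c a = orient3 a b c := (orient3_cyclic a b c).symm
    rw [hbca]
    exact ⟨mul_nonneg h1 h.le, mul_nonneg h0 h.le⟩

/-- **The ball fraction of a dihedral wedge in determinant form** is the angle at the edge
`b` between the faces towards `a` and `c`, over `2π`. [folklore] -/
theorem ballFraction_orient3_wedge {a b c : E3} (h : 0 < orient3 a b c) :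
    ballFraction (0 : E3) ({x : E3 | 0 ≤ orient3 a b x} ∩ {x | 0 ≤ orient3 b c x}) =
      angle (perpTo b a) (perpTo b c) / (2 * π) := by
  have hli : LinearIndependent ℝ ![b - 0, (![a, c] : Fin 2 → E3) 0, (![a, c] : Fin 2 → E3) 1] := by
    simp only [sub_zero, Matrix.cons_val_zero, Matrix.cons_val_one]
    refine linearIndependent_of_orient3_ne_zero ?_
    rw [orient3_swap_left]
    exact neg_ne_zero.2 h.ne'
  rw [setOf_orient3_inter_eq_apexWedge h]
  have := dihedralFraction_eq_angle_div 0 b ![a, c] hli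
  simpa only [dihedralFraction, sub_zero, Matrix.cons_val_zero, Matrix.cons_val_one] using this

/-- **The vertex angle of a polygonal cone as a wedge fraction**:
`ballFraction 0 (dirCone (polyCone n w) (w j)) = polyDih n w j / 2π`. [folklore] -/
theorem ballFraction_dirCone_polyCone_vertex {n : ℕ} (hn : 3 ≤ n) {w : ℕ → E3}
    (hw : ∀ i j k, i < j → j < k → k < n → 0 < orient3 (w i) (w j) (w k)) {j : ℕ}
    (hj : j < n) :
    ballFraction (0 : E3) (dirCone (polyCone n w) (w j)) = polyDih n w j / (2 * π) := by
  have hpos : 0 < orient3 (w ((j + n - 1) % n)) (w j) (w ((j + 1) % n)) := by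
    rcases Nat.eq_zero_or_pos j with rfl | hjpos
    · rw [Nat.zero_add, Nat.mod_eq_of_lt (by omega : n - 1 < n), Nat.zero_add,
        Nat.mod_eq_of_lt (by omega : 1 < n), orient3_cyclic]
      exact hw 0 1 (n - 1) (by omega) (by omega) (by omega)
    · rw [show j + n - 1 = (j - 1) + n by omega, Nat.add_mod_right,
        Nat.mod_eq_of_lt (by omega : j - 1 < n)]
      rcases Nat.lt_or_ge (j + 1) n with h1 | h1
      · rw [Nat.mod_eq_of_lt h1]
        exact hw (j - 1) j (j + 1) (by omega) (by omega) h1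
      · obtain rfl : j = n - 1 := by omega
        rw [show n - 1 + 1 = n by omega, Nat.mod_self, ← orient3_cyclic]
        exact hw 0 (n - 1 - 1) (n - 1) (by omega) (by omega) (by omega)
  rw [dirCone_polyCone_vertex hn hw hj, ballFraction_orient3_wedge hpos, polyDih]

end Wedge

/-! ### Part 4. Girard's theorem in vertex-wedge form -/

section Girard

/-- **The solid angle of a convex polygonal cone is the sum of its vertex-wedge fractions minus
`(n − 2)/4`** (times `4π`: area `= Σ angles − (n − 2)π`), each vertex angle being the ball
fraction of the tangent wedge at that vertex. [folklore] -/
theorem ballFraction_polyCone_eq_sum_dirCone {n : ℕ} (hn : 3 ≤ n) {w : ℕ → E3}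
    (hw : ∀ i j k, i < j → j < k → k < n → 0 < orient3 (w i) (w j) (w k)) :
    ballFraction (0 : E3) (polyCone n w) =
      (1 / 2) * ∑ j ∈ Finset.range n, ballFraction (0 : E3) (dirCone (polyCone n w) (w j)) -
        (n - 2) / 4 := by
  have h := ballFraction_polyCone_apex hn 0 w hw
  simp only [sub_zero, Set.setOf_mem_eq] at h
  rw [h, Finset.sum_congr rfl fun j hj =>
    ballFraction_dirCone_polyCone_vertex hn hw (Finset.mem_range.1 hj)]
  rw [← Finset.sum_div]
  have hπ : π ≠ 0 := Real.pi_ne_zero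
  field_simp
  ring

/-- The vertex-wedge fractions of a convex polygonal cone sum to at least `(n − 2)/2`
(nonnegativity of the excess). [folklore] -/
theorem sum_ballFraction_dirCone_polyCone_ge {n : ℕ} (hn : 3 ≤ n) {w : ℕ → E3}
    (hw : ∀ i j k, i < j → j < k → k < n → 0 < orient3 (w i) (w j) (w k)) :
    ((n : ℝ) - 2) / 2 ≤ ∑ j ∈ Finset.range n, ballFraction (0 : E3) (dirCone (polyCone n w) (w j)) := by
  have h := ballFraction_polyCone_eq_sum_dirCone hn hw
  have h0 : 0 ≤ ballFraction (0 : E3) (polyCone n w) := ballFraction_nonneg _ _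
  rw [h] at h0
  linarith

end Girard

end Literature.Geometry.DiscreteGeometry
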